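import Summits.BirchSwinnertonDyer.Rank1Residual.Iwasawa.LambdaInvariantValuationTwisted
import Mathlib.RingTheory.Polynomial.Resultant.Basic
import HarnessLib

/-!
# The orbit product is a RATIONAL resultant: for `θ ∈ ℚ[X]`,
# `∏_{ζ of order pⁿ⁺¹} θ(ζ − 1) = Res(Φ_{pⁿ⁺¹}(X+1), θ)`, hence the `(μ, λ)` certificate of a
# Mazur–Tate element in EXACT rational arithmetic:
# `v_p(Res(Φ_{pᵏ⁺¹}(X+1), θ_{k+1})) = φ(pᵏ⁺¹)·μ + λ`, and `v_p(Res) = V < φ ⟹ μ = 0 ∧ λ = V`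
# (cell `b2b-bsdres`; class-agnostic kernel support for the (μ, λ) censuses; prover unit
# `b2b-bsdres-additive-p3`, gen 10; part 7)

HONEST FRAMING (run/shared/lean/b2b/bsd-rank1-residual/, verbatim in every file): the goal of the
cell is to DELETE the COMBINATION-SHAPED residual classes of the Birch–Swinnerton-Dyer formula for
ALL analytic-rank `≤ 1` elliptic curves over `ℚ` — "full BSD formula for every rank `≤ 1` curve in
class `C`" assembled STRICTLY from published theorems — so that the rank-`≤ 1` remainder becomes
exactly the CONSTRUCTION-SHAPED classes, which are TYPED (missing-input `Prop`s), NOT attempted.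
This is not "finishing BSD". THEOREMS ONLY; no definition, no named fact; nothing about any curve is
asserted; nothing booked; no label changes.

## What this file proves (parts 1–3: `Iwasawa/LambdaInvariantValuation{,Layer,Twisted}.lean`)

Part 3 §6 identified iw-2's ENGINE T datum `V = v_p(Norm_{ℚ(μ_{pⁿ⁺¹})/ℚ} S_ψ)` with the ORBIT PRODUCT
`∏_{ζ of order pⁿ⁺¹} |G(ζ − 1)|` of an integral model and proved `∏ = p^{−(φμ+λ)}` (`λ < φ`) and
`∏ = p^{−V}, V < φ ⟹ (μ, λ) = (0, V)`, leaving the identification "orbit product = field norm" to the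
engines' bookkeeping. This file makes it LITERAL for polynomials with rational coefficients (the
Mazur–Tate elements `θ_n ∈ ℚ[T]`):
* §18 `prod_eval₂_sub_one_eq_algebraMap_resultant`: for `θ ∈ ℚ[X]` and `n`,
  **`∏_{ζ of order pⁿ⁺¹} θ(ζ − 1) = ι(Res(Φ_{pⁿ⁺¹}(X + 1), θ))`** in `ℂ_p` — Mathlib's Sylvester
  resultant over `ℚ` (`Res(∏(X − r_i), g) = ∏ g(r_i)`; `Φ_{pⁿ⁺¹}(X+1) = ∏_ζ (X − (ζ − 1))` in `ℂ_p`);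
* §19 for an integral model `Θ` of `θ_{k+1}` (`ι(Θ) = θ_{k+1}`): `∏_ζ Θ(ζ − 1) = ι(Res)`, hence
  **`λ(Θ) < φ(pᵏ⁺¹) ⟹ ‖Res‖_p = p^{−(φ(pᵏ⁺¹)·μ(Θ) + λ(Θ))}`**, i.e.
  `padicValRat p (Res(Φ_{pᵏ⁺¹}(X+1), θ_{k+1})) = φ(pᵏ⁺¹)·μ(θ_{k+1}) + λ(θ_{k+1})`
  (`mazurTate_padicValRat_resultant_eq_of_lam_lt_totient`), and the CERTIFICATE IN EXACT RATIONAL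
  ARITHMETIC **`padicValRat p (Res) = V`, `V < φ(pᵏ⁺¹)`, `Res ≠ 0` ⟹ `μ(Θ) = 0 ∧ λ(Θ) = V`**
  (`mazurTate_mu_eq_zero_and_lam_eq_of_padicValRat_resultant_eq`). Given `θ_{k+1} ∈ ℚ[T]` (modular
  symbols, exact), the right-hand side is a Sylvester determinant over `ℚ` — no `p`-adic expansion,
  no rounding; this is ENGINE T's `Norm S_ψ` (`= N_{ℚ(ζ)/ℚ}(θ_{k+1}(ζ−1))`, the norm of a generator of
  the orbit, `Φ_{pᵏ⁺¹}(X+1)` being the minimal polynomial of `ζ − 1`, gen 7) as a closed formula.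

References: [Washington1997] §7.1–7.2; [Lang1990] Ch. 5 §2; Mathlib `Polynomial.resultant`
(`resultant_prod_left`, `resultant_X_sub_C_left`, `resultant_map_map`);
HOME/b2b-bsdres-iw-2/ENGINE-T.md §0; HOME/b2b-bsdres-additive-p3/X8-ROUTE-B.md §15 (gen 10).
-/

set_option autoImplicit false

noncomputable section

open scoped Classical MatrixGroups ModularForm

open CongruenceSubgroup Polynomial WeierstrassCurve Literature.NumberTheory.EllipticCurves
  Literature.NumberTheory.EllipticCurves.ModularForms
  Summit.BirchSwinnertonDyer.Rank1Residual.X1.MuLambda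

namespace Summit.BirchSwinnertonDyer.Rank1Residual.Iwasawa

variable {p : ℕ} [hp : Fact p.Prime]

/-! ## §18. `∏_ζ θ(ζ − 1)` is the resultant `Res(Φ_{pⁿ⁺¹}(X+1), θ)` -/

section Resultant

/-- In `ℂ_p`, `Φ_{pⁿ⁺¹}(X + 1) = ∏_{ζ of order pⁿ⁺¹} (X − (ζ − 1))`. [folklore] -/
theorem map_cyclotomic_comp_X_add_one_eq_prod {n : ℕ} {ζ₀ : ℂ_[p]}
    (hζ₀ : IsPrimitiveRoot ζ₀ (p ^ (n + 1))) :
    ((cyclotomic (p ^ (n + 1)) ℚ).comp (X + 1)).map (algebraMap ℚ ℂ_[p]) =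
      ∏ ζ ∈ primitiveRoots (p ^ (n + 1)) ℂ_[p], (X - C (ζ - 1)) := by
  rw [map_comp, map_cyclotomic, Polynomial.map_add, map_X, Polynomial.map_one,
    cyclotomic_eq_prod_X_sub_primitiveRoots hζ₀, prod_comp]
  refine Finset.prod_congr rfl fun ζ _ ↦ ?_
  rw [sub_comp, X_comp, C_comp, map_sub, C_1]
  ring

/-- **The orbit product is a rational resultant**: for `θ ∈ ℚ[X]`,
`ι(Res(Φ_{pⁿ⁺¹}(X+1), θ)) = ∏_{ζ of order pⁿ⁺¹} θ(ζ − 1)` in `ℂ_p` (Sylvester resultant with the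
degree parameters `φ(pⁿ⁺¹)`, `deg θ`). [folklore] -/
theorem prod_eval₂_sub_one_eq_algebraMap_resultant (θ : ℚ[X]) {n : ℕ} {ζ₀ : ℂ_[p]}
    (hζ₀ : IsPrimitiveRoot ζ₀ (p ^ (n + 1))) :
    algebraMap ℚ ℂ_[p] (resultant ((cyclotomic (p ^ (n + 1)) ℚ).comp (X + 1)) θ
        (Nat.totient (p ^ (n + 1))) θ.natDegree) =
      ∏ ζ ∈ primitiveRoots (p ^ (n + 1)) ℂ_[p], θ.eval₂ (algebraMap ℚ ℂ_[p]) (ζ - 1) := by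
  set φ := algebraMap ℚ ℂ_[p] with hφ
  rw [← resultant_map_map _ _ _ _ φ, map_cyclotomic_comp_X_add_one_eq_prod hζ₀]
  -- the degree parameter `φ(p^{n+1})` is the degree of the product
  have hdeg : (∏ ζ ∈ primitiveRoots (p ^ (n + 1)) ℂ_[p], (X - C (ζ - 1))).natDegree =
      Nat.totient (p ^ (n + 1)) := by
    rw [natDegree_prod_of_monic _ _ fun ζ _ ↦ monic_X_sub_C (ζ - 1)]
    simp only [natDegree_X_sub_C, Finset.sum_const, smul_eq_mul, mul_one]
    exact hζ₀.card_primitiveRoots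
  have hlc : ∏ ζ ∈ primitiveRoots (p ^ (n + 1)) ℂ_[p], (X - C (ζ - 1)).leadingCoeff ≠ 0 := by
    rw [Finset.prod_eq_one fun ζ _ ↦ leadingCoeff_X_sub_C (ζ - 1)]
    exact one_ne_zero
  have hle : (θ.map φ).natDegree ≤ θ.natDegree := natDegree_map_le
  rw [← hdeg, resultant_prod_left _ _ _ _ hlc hle]
  refine Finset.prod_congr rfl fun ζ _ ↦ ?_
  rw [natDegree_X_sub_C, resultant_X_sub_C_left _ _ _ hle, eval_map]

/-- A rational number of `p`-adic absolute value `p^{−m}` (`m ∈ ℕ`) has `padicValRat = m`. [folklore] -/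
theorem padicValRat_eq_of_norm_eq {r : ℚ} (hr : r ≠ 0) {m : ℕ}
    (h : ‖(r : ℚ_[p])‖ = ((p : ℝ)⁻¹) ^ m) : padicValRat p r = m := by
  have hp1 : (1 : ℝ) < p := by exact_mod_cast hp.out.one_lt
  have hp0 : (0 : ℝ) < p := lt_trans one_pos hp1
  rw [Padic.eq_padicNorm, padicNorm.eq_zpow_of_nonzero hr] at h
  push_cast at h
  rw [inv_pow, ← zpow_natCast, ← zpow_neg] at h
  have hinj := zpow_right_injective₀ hp0 hp1.ne' h
  omega

/-- `‖ι_{ℂ_p}(r)‖ = ‖(r : ℚ_p)‖` for a rational `r`. [folklore] -/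
theorem norm_algebraMap_rat (r : ℚ) : ‖algebraMap ℚ ℂ_[p] r‖ = ‖(r : ℚ_[p])‖ := by
  rw [show algebraMap ℚ ℂ_[p] r = algebraMap ℚ_[p] ℂ_[p] (r : ℚ_[p]) by
    rw [eq_ratCast, ← map_ratCast (algebraMap ℚ_[p] ℂ_[p]) r], norm_algebraMap']

end Resultant

/-! ## §19. Mazur–Tate elements: the certificate in exact rational arithmetic -/

section MazurTate

variable {N : ℕ} {f : CuspForm (Gamma0 N) 2}

/-- An integral model `Θ` of `θ_n` evaluates at ANY `z` to `θ_n(z)` (finite sum).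
[cite: MazurTateTeitelbaum1986Invent, §I.8 and §I.12] -/
theorem hasSum_mazurTate_eq_eval₂ {n : ℕ} {Θ : IwasawaAlgebra p}
    (hΘ : iwasawaToPowerSeries p Θ =
      ((mazurTateElement f p n).map (algebraMap ℚ ℚ_[p]) : PowerSeries ℚ_[p])) (z : ℂ_[p]) :
    HasSum (fun k ↦ ((algebraMap ℚ_[p] ℂ_[p]).comp (algebraMap ℤ_[p] ℚ_[p]))
        (PowerSeries.coeff k Θ) * z ^ k) ((mazurTateElement f p n).eval₂ (algebraMap ℚ ℂ_[p]) z) := by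
  have h := hasSum_map_coeff_coe_mul_pow (algebraMap ℚ ℂ_[p]) (mazurTateElement f p n) z
  refine h.congr_fun fun k ↦ ?_
  have hk : algebraMap ℤ_[p] ℚ_[p] (PowerSeries.coeff k Θ) =
      algebraMap ℚ ℚ_[p] ((mazurTateElement f p n).coeff k) := by
    have h1 := congr_arg (PowerSeries.coeff k) hΘ
    rw [iwasawaToPowerSeries, PowerSeries.coeff_map, Polynomial.coeff_coe, Polynomial.coeff_map] at h1
    exact h1
  show ((algebraMap ℚ_[p] ℂ_[p]).comp (algebraMap ℤ_[p] ℚ_[p])) (PowerSeries.coeff k Θ) * z ^ k =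
    algebraMap ℚ ℂ_[p] (PowerSeries.coeff k (mazurTateElement f p n : PowerSeries ℚ)) * z ^ k
  rw [Polynomial.coeff_coe, RingHom.comp_apply, hk]
  congr 1
  simp only [eq_ratCast, map_ratCast]

/-- **`v_p(Res(Φ_{pᵏ⁺¹}(X+1), θ_{k+1})) = φ(pᵏ⁺¹)·μ + λ`**: for an integral model `Θ ≠ 0` of `θ_{k+1}`
with `λ(Θ) < φ(pᵏ⁺¹)`, the RATIONAL number
`R = Res(Φ_{pᵏ⁺¹}(X+1), θ_{k+1})` (degree parameters `φ(pᵏ⁺¹)`, `deg θ_{k+1}`) has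
`‖R‖_p = p^{−(φ(pᵏ⁺¹)·μ(Θ) + λ(Θ))}`. [cite: Washington1997, §7.1–7.2 and Thm. 7.3]
[cite: MazurTateTeitelbaum1986Invent, §I.8 and §I.12] -/
theorem mazurTate_norm_resultant_eq_of_lam_lt_totient {k : ℕ} {Θ : IwasawaAlgebra p}
    (hΘ : iwasawaToPowerSeries p Θ =
      ((mazurTateElement f p (k + 1)).map (algebraMap ℚ ℚ_[p]) : PowerSeries ℚ_[p]))
    (hΘ0 : Θ ≠ 0) {ζ₀ : ℂ_[p]} (hζ₀ : IsPrimitiveRoot ζ₀ (p ^ (k + 1)))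
    (hlam : lam Θ < Nat.totient (p ^ (k + 1))) :
    ‖((resultant ((cyclotomic (p ^ (k + 1)) ℚ).comp (X + 1)) (mazurTateElement f p (k + 1))
        (Nat.totient (p ^ (k + 1))) (mazurTateElement f p (k + 1)).natDegree : ℚ) : ℚ_[p])‖ =
      ((p : ℝ)⁻¹) ^ (Nat.totient (p ^ (k + 1)) * mu Θ + lam Θ) := by
  rw [← norm_algebraMap_rat, prod_eval₂_sub_one_eq_algebraMap_resultant _ hζ₀, norm_prod,
    ← prod_norm_tsum_eq_of_lam_lt_totient hΘ0 hζ₀ hlam]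
  refine Finset.prod_congr rfl fun ζ _ ↦ ?_
  rw [(hasSum_mazurTate_eq_eval₂ hΘ (ζ - 1)).tsum_eq]

/-- **`padicValRat` form**: under the same hypotheses and `R ≠ 0`,
`padicValRat p R = φ(pᵏ⁺¹)·μ(Θ) + λ(Θ)`. [cite: Washington1997, §7.1–7.2 and Thm. 7.3] -/
theorem mazurTate_padicValRat_resultant_eq_of_lam_lt_totient {k : ℕ} {Θ : IwasawaAlgebra p}
    (hΘ : iwasawaToPowerSeries p Θ =
      ((mazurTateElement f p (k + 1)).map (algebraMap ℚ ℚ_[p]) : PowerSeries ℚ_[p]))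
    (hΘ0 : Θ ≠ 0) {ζ₀ : ℂ_[p]} (hζ₀ : IsPrimitiveRoot ζ₀ (p ^ (k + 1)))
    (hlam : lam Θ < Nat.totient (p ^ (k + 1)))
    (hR : resultant ((cyclotomic (p ^ (k + 1)) ℚ).comp (X + 1)) (mazurTateElement f p (k + 1))
        (Nat.totient (p ^ (k + 1))) (mazurTateElement f p (k + 1)).natDegree ≠ 0) :
    padicValRat p (resultant ((cyclotomic (p ^ (k + 1)) ℚ).comp (X + 1))
        (mazurTateElement f p (k + 1)) (Nat.totient (p ^ (k + 1)))
        (mazurTateElement f p (k + 1)).natDegree) =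
      (Nat.totient (p ^ (k + 1)) * mu Θ + lam Θ : ℕ) :=
  padicValRat_eq_of_norm_eq hR (mazurTate_norm_resultant_eq_of_lam_lt_totient hΘ hΘ0 hζ₀ hlam)

/-- **THE CERTIFICATE IN EXACT RATIONAL ARITHMETIC.** `Θ ≠ 0` an integral model of `θ_{k+1}`;
`R = Res(Φ_{pᵏ⁺¹}(X+1), θ_{k+1}) ∈ ℚ` (Sylvester determinant, degree parameters `φ(pᵏ⁺¹)`,
`deg θ_{k+1}`). If **`‖R‖_p = p^{−V}` with `V < φ(pᵏ⁺¹)`** then `μ(Θ) = 0` and `λ(Θ) = V`.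
[cite: Washington1997, §7.1–7.2 and Thm. 7.3] [cite: MazurTateTeitelbaum1986Invent, §I.8 and §I.12] -/
theorem mazurTate_mu_eq_zero_and_lam_eq_of_norm_resultant_eq {k : ℕ} {Θ : IwasawaAlgebra p}
    (hΘ : iwasawaToPowerSeries p Θ =
      ((mazurTateElement f p (k + 1)).map (algebraMap ℚ ℚ_[p]) : PowerSeries ℚ_[p]))
    (hΘ0 : Θ ≠ 0) {ζ₀ : ℂ_[p]} (hζ₀ : IsPrimitiveRoot ζ₀ (p ^ (k + 1))) {V : ℕ}
    (hV : V < Nat.totient (p ^ (k + 1)))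
    (h : ‖((resultant ((cyclotomic (p ^ (k + 1)) ℚ).comp (X + 1)) (mazurTateElement f p (k + 1))
        (Nat.totient (p ^ (k + 1))) (mazurTateElement f p (k + 1)).natDegree : ℚ) : ℚ_[p])‖ =
      ((p : ℝ)⁻¹) ^ V) :
    mu Θ = 0 ∧ lam Θ = V := by
  refine mu_eq_zero_and_lam_eq_of_prod_norm_tsum_eq hΘ0 hζ₀ hV ?_
  rw [← h, ← norm_algebraMap_rat, prod_eval₂_sub_one_eq_algebraMap_resultant _ hζ₀, norm_prod]
  refine Finset.prod_congr rfl fun ζ _ ↦ ?_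
  rw [(hasSum_mazurTate_eq_eval₂ hΘ (ζ - 1)).tsum_eq]

/-- **`padicValRat` form of the certificate**: `R ≠ 0`, `padicValRat p R = V < φ(pᵏ⁺¹)` ⟹
`μ(Θ) = 0 ∧ λ(Θ) = V` — ENGINE T's rule with its datum computed by rational arithmetic from
`θ_{k+1} ∈ ℚ[T]`. [cite: Washington1997, §7.1–7.2 and Thm. 7.3] [cite: MazurTateTeitelbaum1986Invent, §I.8 and §I.12] -/
theorem mazurTate_mu_eq_zero_and_lam_eq_of_padicValRat_resultant_eq {k : ℕ} {Θ : IwasawaAlgebra p}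
    (hΘ : iwasawaToPowerSeries p Θ =
      ((mazurTateElement f p (k + 1)).map (algebraMap ℚ ℚ_[p]) : PowerSeries ℚ_[p]))
    (hΘ0 : Θ ≠ 0) {ζ₀ : ℂ_[p]} (hζ₀ : IsPrimitiveRoot ζ₀ (p ^ (k + 1))) {V : ℕ}
    (hV : V < Nat.totient (p ^ (k + 1)))
    (hR : resultant ((cyclotomic (p ^ (k + 1)) ℚ).comp (X + 1)) (mazurTateElement f p (k + 1))
        (Nat.totient (p ^ (k + 1))) (mazurTateElement f p (k + 1)).natDegree ≠ 0)
    (h : padicValRat p (resultant ((cyclotomic (p ^ (k + 1)) ℚ).comp (X + 1))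
        (mazurTateElement f p (k + 1)) (Nat.totient (p ^ (k + 1)))
        (mazurTateElement f p (k + 1)).natDegree) = V) :
    mu Θ = 0 ∧ lam Θ = V := by
  refine mazurTate_mu_eq_zero_and_lam_eq_of_norm_resultant_eq hΘ hΘ0 hζ₀ hV ?_
  rw [Padic.eq_padicNorm, padicNorm.eq_zpow_of_nonzero hR, h]
  push_cast
  rw [inv_pow, ← zpow_natCast, ← zpow_neg]

end MazurTate

end Summit.BirchSwinnertonDyer.Rank1Residual.Iwasawa

end
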